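import Literature.LinearAlgebra.Matrix.GerstenhaberNilpotentSubspaceEquality

/-!
# `GrenetZeon.DualUnipotentThreeHalves` (stmt-ValiantsHypothesis-24318), R2 heavy-top instrument — DEFINITION of the TOWER HULL
# `T(p, I, q) = HULL(𝔫_p, I, 𝔫_q)` (the codimension-one nilpotent spaces that are not triangularisable; val-idea-30 MEMO codim-one COROLLARY II)

Definitions only (no claims).  For `p q : ℕ` and a linear space `I ≤ M₃(ℂ)` the TOWER HULL `towerHull p q I ≤ M_{p+3+q}(ℂ)` is the space of block
upper-triangular matrices for the block sizes `(p, 3, q)` whose diagonal blocks are strictly upper triangular (`𝔫_p`), a member of `I`, and strictly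
upper triangular (`𝔫_q`), with ARBITRARY entries in the three blocks above the diagonal.  With `I` an irreducible nilpotent plane of `M₃(ℂ)` (e.g.
`Irr₃ = span{E₁₂ + E₂₃, E₂₁ − E₃₂}`) this is val-idea-30's tower `T(p, I, q)`: a nilpotent space of dimension `C(p+3+q, 2) − 1` that is NOT
triangularisable; COROLLARY II of the codim-one memo (rev 1.2, V88) states that every nilpotent subspace of `M_m(ℂ)` of dimension `C(m,2) − 1`
is conjugate to a hyperplane of `𝔫_m` or to such a tower.  The classification theorem and the lemmas live in `…HeavyTopCodimOneClassification`
(to come); this file only fixes the vocabulary (director R504-htc (2)(a)).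

* `blk p i` — the block index (`0`, `1`, `2`) of a row/column index `i` for the block sizes `(p, 3, ·)`; `midBlock p q` — the middle
  `3 × 3` diagonal block as a linear map; `towerShape p q` — the block upper-triangular shape with strictly upper outer diagonal blocks;
* `towerHull p q I := towerShape p q ⊓ I.comap (midBlock p q)` — the tower hull; `midBlock_apply`, `mem_towerHull` — unfoldings.

Honest framing: vocabulary; nothing here proves or refutes `HeavyTopLaw`, 24318, S3b or 8062; `VP ≠ VNP` is NOT proved.
[val-idea-30 MEMO codim-one rev 1.2 §0 COROLLARY II / §4 (ii); cell val-heavytop-census, eng-1 g5]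
-/

noncomputable section

-- single-conjunct layout: Sub = Summit, duplicated namespace component intended
set_option linter.dupNamespace false

namespace Summit.ValiantsHypothesis.ValiantsHypothesis.Theorems.GrenetZeon.HeavyTopTowerDefs

open Matrix

/-- The block index of `i` for the block sizes `(p, 3, ·)`: `0` on `[0, p)`, `1` on `[p, p+3)`, `2` on `[p+3, ·)`. -/
def blk (p : ℕ) (i : ℕ) : ℕ := if i < p then 0 else if i < p + 3 then 1 else 2

/-- The middle `3 × 3` diagonal block of a matrix of size `p + 3 + q` (rows/columns `p, p+1, p+2`), as a linear map. -/
def midBlock (p q : ℕ) : Matrix (Fin (p + 3 + q)) (Fin (p + 3 + q)) ℂ →ₗ[ℂ] Matrix (Fin 3) (Fin 3) ℂ where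
  toFun A := Matrix.of fun a b : Fin 3 => A ⟨p + (a : ℕ), by omega⟩ ⟨p + (b : ℕ), by omega⟩
  map_add' A B := by ext a b; rfl
  map_smul' c A := by ext a b; rfl

/-- The block upper-triangular SHAPE for the block sizes `(p, 3, q)` with strictly upper triangular outer diagonal blocks and a free middle
diagonal block: `A i j = 0` whenever `blk j < blk i`, or `blk i = blk j ≠ 1` and `j ≤ i`. -/
def towerShape (p q : ℕ) : Submodule ℂ (Matrix (Fin (p + 3 + q)) (Fin (p + 3 + q)) ℂ) where
  carrier := {A | (∀ i j : Fin (p + 3 + q), blk p j < blk p i → A i j = 0) ∧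
    (∀ i j : Fin (p + 3 + q), blk p i = blk p j → blk p i ≠ 1 → (j : ℕ) ≤ (i : ℕ) → A i j = 0)}
  add_mem' := by
    rintro A B ⟨hA1, hA2⟩ ⟨hB1, hB2⟩
    exact ⟨fun i j h => by rw [Matrix.add_apply, hA1 i j h, hB1 i j h, add_zero],
      fun i j h h1 hji => by rw [Matrix.add_apply, hA2 i j h h1 hji, hB2 i j h h1 hji, add_zero]⟩
  zero_mem' := ⟨fun _ _ _ => rfl, fun _ _ _ _ _ => rfl⟩
  smul_mem' := by
    rintro c A ⟨hA1, hA2⟩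
    exact ⟨fun i j h => by rw [Matrix.smul_apply, hA1 i j h, smul_zero],
      fun i j h h1 hji => by rw [Matrix.smul_apply, hA2 i j h h1 hji, smul_zero]⟩

/-- **The tower hull `T(p, I, q) = HULL(𝔫_p, I, 𝔫_q)`**: matrices of tower shape whose middle diagonal block lies in `I ≤ M₃(ℂ)`.
[val-idea-30 MEMO codim-one, COROLLARY II] -/
def towerHull (p q : ℕ) (I : Submodule ℂ (Matrix (Fin 3) (Fin 3) ℂ)) :
    Submodule ℂ (Matrix (Fin (p + 3 + q)) (Fin (p + 3 + q)) ℂ) :=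
  towerShape p q ⊓ I.comap (midBlock p q)

/-- Entries of the middle block. -/
theorem midBlock_apply (p q : ℕ) (A : Matrix (Fin (p + 3 + q)) (Fin (p + 3 + q)) ℂ) (a b : Fin 3) :
    midBlock p q A a b = A ⟨p + (a : ℕ), by omega⟩ ⟨p + (b : ℕ), by omega⟩ := rfl

/-- Membership in the tower hull, unfolded. -/
theorem mem_towerHull {p q : ℕ} {I : Submodule ℂ (Matrix (Fin 3) (Fin 3) ℂ)} {A : Matrix (Fin (p + 3 + q)) (Fin (p + 3 + q)) ℂ} :
    A ∈ towerHull p q I ↔ ((∀ i j : Fin (p + 3 + q), blk p j < blk p i → A i j = 0) ∧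
      (∀ i j : Fin (p + 3 + q), blk p i = blk p j → blk p i ≠ 1 → (j : ℕ) ≤ (i : ℕ) → A i j = 0)) ∧
      midBlock p q A ∈ I :=
  Iff.rfl

end Summit.ValiantsHypothesis.ValiantsHypothesis.Theorems.GrenetZeon.HeavyTopTowerDefs

end
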